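import Literature.NumberTheory.LFunctions.SelbergClassLiCriterion
import HarnessLib

/-!
# The τ-Li criterion for zero-free half-planes in the Selberg class (Bucur–Ernvall-Hytönen–Odžak–Smajlović; Droll; Freitas)

LABEL (line 1): **RH-FREE** equivalences — for every Selberg datum `F` and every `τ ≥ 1`:
"`F` has no non-trivial zero with `Re ρ > τ/2`" `⟺` "the τ-Li coefficients satisfy `Re λ_F(n,τ) ≥ 0`
for all `n ≥ 1`" `⟺` "they are bounded below sub-exponentially" (PROVED in the kernel from the tree's
generalized Bombieri–Lagarias theorem `sekatskii2014_thm2_of_lt` / `Sekatskii2014_thm2c_holds`); at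
`τ = 1` the left side IS RH for `F` (**RH-EQUIVALENT for `F ∈ 𝒮`**), and for `τ ≥ 2` it is TRUE
(zeros lie in the open critical strip), so the τ-Li coefficients of every `F ∈ 𝒮` are unconditionally
`≥ 0` for `τ ≥ 2` (the Selberg-class analogue of Freitas' unconditional shifted positivity for `ζ`).
bears_on: LADDER-RH L-C (COLUMN 4, LI; Selberg-class row; "generalized / shifted Li criteria").
WHAT THIS IS NOT: a zero-free half-plane `Re s > τ/2` with `τ < 2` for any `F ∈ 𝒮` is neither asserted
nor approached — the criterion fixes WHICH positivity statement it is; for `τ ≥ 2` the positivity is a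
restatement of "no zeros with `Re s ≥ 1`"; nothing here bears on the truth of RH (or of GRH for any `F`).

Source (held, open access): A. Bucur, A.-M. Ernvall-Hytönen, A. Odžak, L. Smajlović, *On a Li-type
criterion for zero-free regions of certain Dirichlet series with real coefficients*, LMS J. Comput.
Math. **19** (2016) 259–280 [BucurEtAl2016] (`lit read paper:doi-10-1112-s1461157016000115`; locators
`pNNNN` = PDF pages, p0001 = journal p. 259): the τ-Li coefficients (1.2) (p. 260), Theorem 3.3
(p. 264) and Corollary 3.4 (p. 266).  The criterion goes back to P. Freitas (J. LMS 73 (2006), for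
`ζ`: tree `FreitasLiHalfPlanes.lean`, and Sekatskii's Theorem 6: `sekatskii2014_thm6_holds'`) and to
A. Droll's thesis (Queen's Univ. 2012, for the class `𝒮♯♭`, `τ ∈ [1,2]`; [BucurEtAl2016, ref. [6]]).

## Dictionary (paper ↦ tree) and TYPING NOTE

* The paper's class `𝒮_ℝ^♯` (extended Selberg class, REAL Dirichlet coefficients and real `μ_j`, no
  Euler product required — it contains e.g. the Davenport–Heilbronn function) is not a tree structure;
  the statements are typed for the tree's `SelbergDatum` (`F ∈ 𝒮`, complex coefficients allowed), for
  which (a) the non-trivial zeros `D.nontrivialZeros` (open strip) with multiplicities `D.zeroMult`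
  and their symmetry `ρ ↦ 1 − ρ̄` (`one_sub_conj_mem_nontrivialZeros`) and (b) the convergence
  `Σ_ρ m(ρ)/(1+|ρ|²) < ∞` (`liZeroSumSummable_holds`) are in the tree.  As in the sibling file
  (`liCoeffRe`, `liSekatskiiRe`) only the REAL PARTS of the zero sums are typed:
  `λ_F(n,τ) = Σ*_ρ (1 − (ρ/(ρ−τ))ⁿ)` (1.2) ↦ `SelbergDatum.liTauRe τ n := Σ' ρ, m(ρ)·Re[1 − (ρ/(ρ−τ))ⁿ]`
  (absolutely convergent; for `F` with real coefficients `λ_F(n,τ)` is real, Remark 1 p. 263, and the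
  two agree).  The hypothesis "`0, τ ∉ Z(F)`" of Thm 3.3 is automatic here (`0 < Re ρ < 1 ≤ τ`).
  -- TODO(general form): the class `𝒮_ℝ^♯` itself (no Euler product); the multiset statement behind
  -- Theorem 3.3 for an ARBITRARY multiset is the tree's `sekatskii2014_thm2_of_lt` (`a = 0`, `σ = τ/2`).
* Theorem 3.3 (iv) (`limsup |λ_F(n+1,τ)|^{1/n} ≤ 1`, radius of convergence of (3.4)) and Prop. 3.2
  (the derivative formula `λ_F(n,τ) = (τ/(n−1)!) dⁿ/dsⁿ[s^{n−1} log ξ_F(s)]_{s=τ}`) are deliberately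
  NOT typed (for `ζ` the latter is `Sekatskii2014_sum_eq_deriv_holds` with `a = 0`, `σ = τ/2`).

## Contents (source item ↦ declaration)

* (1.2) ↦ `SelbergDatum.liTauRe`; `liTauRe_one_eq_liSekatskiiRe_zero` (`τ = 1`: the Li–Sekatskii
  sum with `a = 0`).
* Thm 3.3 (i)⟺(ii) ↦ `forall_re_le_iff_liTauRe_nonneg` (any `τ > 0` with `τ ∉ Z(F)`),
  `bucurEtAl2016_thm_3_3` (`τ ≥ 1`, as printed); (iii)⟹(i) ↦ `forall_re_le_of_liTauRe_subexp`,
  (i)⟺(iii) ↦ `bucurEtAl2016_thm_3_3_iii`; constant lower bound ↦ `forall_re_le_of_liTauRe_bddBelow`.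
* Cor 3.4 (strip `1 − τ/2 ≤ Re s ≤ τ/2`) ↦ `bucurEtAl2016_cor_3_4`.
* Consequences PROVED here: `liTauRe_nonneg_of_two_le` (RH-FREE positivity for `τ ≥ 2`),
  `riemannHypothesis_iff_liTauRe_one_nonneg` (`τ = 1`: RH_F-EQUIVALENT); and the identification at
  `τ = 1`: `zeroMult_one_sub_conj` (multiplicities are invariant under `ρ ↦ 1 − ρ̄`, Prop 2.1 (i)),
  `liTauRe_one_eq_liCoeffRe` (`Re λ_F(n,1) = Re λ_F(n)`, the sibling file's Li coefficients),
  `liSekatskiiRe_zero_eq_liCoeffRe`.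

## References

* [BucurEtAl2016] A. Bucur, A.-M. Ernvall-Hytönen, A. Odžak, L. Smajlović, LMS J. Comput. Math. 19
  (2016) 259–280, (1.2), Thm 3.3, Cor 3.4.
* [Freitas2006LiHalfPlanes] P. Freitas, J. London Math. Soc. (2) 73 (2006) 399–414.
* [Sekatskii2014] S. K. Sekatskii, Ukr. Math. J. 66 (2014) 415–431, Thm 2.
* A. Droll, *Variations of Li's criterion for an extension of the Selberg class*, PhD thesis, Queen's
  University (2012) ([BucurEtAl2016, ref. [6]]).
-/

noncomputable section

open Complex Filter Topology Set
open scoped ComplexConjugate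

namespace Literature.NumberTheory.LFunctions

namespace SelbergDatum

variable (D : SelbergDatum)

/-! ### The τ-Li coefficients (real parts) -/

/-- **`Re λ_F(n,τ)`**, the real part of the `n`-th τ-Li coefficient of `F ∈ 𝒮`,
`λ_F(n,τ) = Σ*_ρ (1 − (ρ/(ρ−τ))ⁿ)` over the non-trivial zeros ((1.2), p. 260), as the absolutely
convergent sum `Σ' ρ, m(ρ)·Re[1 − (ρ/(ρ−τ))ⁿ]` with multiplicities (for `F` with real coefficients
`λ_F(n,τ)` is real, Remark 1, p. 263).  `τ = 1` gives `Re λ_F(n)` in its `λ_F(−n)` form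
(`liTauRe_one_eq_liSekatskiiRe_zero`). [cite: BucurEtAl2016, eq. (1.2) (p. 260)] -/
def liTauRe (τ : ℝ) (n : ℕ) : ℝ :=
  ∑' ρ : D.nontrivialZeros, (D.zeroMult ρ : ℝ) * (1 - ((ρ : ℂ) / ((ρ : ℂ) - τ)) ^ n).re

variable {D}

/-- At `τ = 1` the τ-Li sum is the Li–Sekatskii sum with base point `a = 0`
(`(ρ − 0)/(ρ + 0 − 1) = ρ/(ρ − 1)`). [cite: BucurEtAl2016, eq. (1.2) (p. 260)] -/
theorem liTauRe_one_eq_liSekatskiiRe_zero (n : ℕ) : D.liTauRe 1 n = D.liSekatskiiRe 0 n := by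
  unfold liTauRe liSekatskiiRe
  refine tsum_congr fun ρ ↦ ?_
  simp only [Complex.ofReal_zero, Complex.ofReal_one, sub_zero, add_zero]

/-- The τ-Li sum is Sekatskii's sum with `a = 0`, `σ = τ/2`
(`(ρ − 0)/(ρ + 0 − 2·(τ/2)) = ρ/(ρ − τ)`). [cite: BucurEtAl2016, eq. (1.2) (p. 260)] -/
theorem liTauRe_eq_sekatskiiSum (τ : ℝ) (n : ℕ) :
    D.liTauRe τ n = ∑' ρ : D.nontrivialZeros, (D.zeroMult ρ : ℝ) *
      (1 - (((ρ : ℂ) - ((0 : ℝ) : ℂ)) / ((ρ : ℂ) + ((0 : ℝ) : ℂ) - 2 * ((τ / 2 : ℝ) : ℂ))) ^ n).re := by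
  unfold liTauRe
  refine tsum_congr fun ρ ↦ ?_
  have h2 : (2 : ℂ) * ((τ / 2 : ℝ) : ℂ) = (τ : ℂ) := by push_cast; ring
  rw [Complex.ofReal_zero, sub_zero, add_zero, h2]

/-- Under the convergence fact, Sekatskii's weight (ii) at any level `σ` and base point `a` is summable
for the non-trivial zeros of `F` (`(1+|Re ρ|)/(1+|ρ+a−2σ|²) ≤ 2(2 + 2(2σ−a)²)/(1+|ρ|²)` on the strip;
the sibling file's `summable_sekatskiiWeight` is `σ = ½`). [cite: Sekatskii2014, Thm 2 (ii)] -/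
theorem summable_sekatskiiWeight_at (h : D.LiZeroSumSummable) (a σ : ℝ) :
    Summable (Sekatskii.weight a σ (fun ρ : D.nontrivialZeros ↦ (ρ : ℂ))
      (fun ρ ↦ D.zeroMult ρ)) := by
  set K : ℝ := 2 + 2 * (2 * σ - a) ^ 2 with hK
  refine Summable.of_nonneg_of_le (fun ρ ↦ Sekatskii.weight_nonneg _ _ _ _ ρ) (fun ρ ↦ ?_)
    (h.mul_left (2 * K))
  obtain ⟨-, h0, h1⟩ := ρ.2
  unfold Sekatskii.weight
  have hre : 1 + |(ρ : ℂ).re| ≤ 2 := by rw [abs_of_pos h0]; linarith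
  have hsplit : (ρ : ℂ) = ((ρ : ℂ) + a - 2 * (σ : ℂ)) + ((2 * σ - a : ℝ) : ℂ) := by
    push_cast; ring
  have htri : ‖(ρ : ℂ)‖ ≤ ‖(ρ : ℂ) + a - 2 * (σ : ℂ)‖ + |2 * σ - a| := by
    calc ‖(ρ : ℂ)‖ = ‖((ρ : ℂ) + a - 2 * (σ : ℂ)) + ((2 * σ - a : ℝ) : ℂ)‖ := by rw [← hsplit]
      _ ≤ ‖(ρ : ℂ) + a - 2 * (σ : ℂ)‖ + ‖((2 * σ - a : ℝ) : ℂ)‖ := norm_add_le _ _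
      _ = _ := by rw [Complex.norm_real, Real.norm_eq_abs]
  have hden : 1 + ‖(ρ : ℂ)‖ ^ 2 ≤ K * (1 + ‖(ρ : ℂ) + a - 2 * (σ : ℂ)‖ ^ 2) := by
    have hsq : ‖(ρ : ℂ)‖ ^ 2 ≤ 2 * ‖(ρ : ℂ) + a - 2 * (σ : ℂ)‖ ^ 2 + 2 * (2 * σ - a) ^ 2 := by
      calc ‖(ρ : ℂ)‖ ^ 2 ≤ (‖(ρ : ℂ) + a - 2 * (σ : ℂ)‖ + |2 * σ - a|) ^ 2 :=
            pow_le_pow_left₀ (norm_nonneg _) htri 2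
        _ ≤ 2 * ‖(ρ : ℂ) + a - 2 * (σ : ℂ)‖ ^ 2 + 2 * |2 * σ - a| ^ 2 := by
            nlinarith [sq_nonneg (‖(ρ : ℂ) + a - 2 * (σ : ℂ)‖ - |2 * σ - a|)]
        _ = _ := by rw [sq_abs]
    rw [hK]
    nlinarith [sq_nonneg ‖(ρ : ℂ) + a - 2 * (σ : ℂ)‖, sq_nonneg (2 * σ - a)]
  have hpos : 0 < 1 + ‖(ρ : ℂ) + a - 2 * (σ : ℂ)‖ ^ 2 := by positivity
  have hpos' : 0 < 1 + ‖(ρ : ℂ)‖ ^ 2 := by positivity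
  have hK0 : 0 < K := by positivity
  calc (D.zeroMult ρ : ℝ) * ((1 + |(ρ : ℂ).re|) / (1 + ‖(ρ : ℂ) + a - 2 * (σ : ℂ)‖ ^ 2))
      ≤ (D.zeroMult ρ : ℝ) * (2 * (K / (1 + ‖(ρ : ℂ)‖ ^ 2))) := by
        gcongr (D.zeroMult ρ : ℝ) * ?_
        calc (1 + |(ρ : ℂ).re|) / (1 + ‖(ρ : ℂ) + a - 2 * (σ : ℂ)‖ ^ 2)
            ≤ 2 / (1 + ‖(ρ : ℂ) + a - 2 * (σ : ℂ)‖ ^ 2) := by gcongr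
          _ = 2 * (1 / (1 + ‖(ρ : ℂ) + a - 2 * (σ : ℂ)‖ ^ 2)) := by ring
          _ ≤ 2 * (K / (1 + ‖(ρ : ℂ)‖ ^ 2)) := by
              gcongr 2 * ?_
              rw [div_le_div_iff₀ hpos hpos']
              linarith
    _ = 2 * K * ((D.zeroMult ρ : ℝ) / (1 + ‖(ρ : ℂ)‖ ^ 2)) := by ring

/-- For `τ ≥ 1`, `τ` is not a non-trivial zero (`Re ρ < 1 ≤ τ`): the hypothesis "`τ ∉ Z(F)`" of
Theorem 3.3 is automatic for `F ∈ 𝒮`. [cite: BucurEtAl2016, Thm 3.3 (hypotheses)] -/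
theorem coe_ne_of_one_le {τ : ℝ} (hτ : 1 ≤ τ) (ρ : D.nontrivialZeros) : (ρ : ℂ) ≠ (τ : ℂ) := by
  intro h
  have h1 := ρ.2.2.2
  rw [h, Complex.ofReal_re] at h1
  linarith

/-- Hypothesis (i) of Sekatskii's Theorem 2 for `a = 0`, `σ = τ/2`: `ρ ≠ 2σ − a = τ`. [folklore] -/
private theorem coe_ne_two_mul_half_sub_zero {τ : ℝ} (hτZ : ∀ ρ : D.nontrivialZeros, (ρ : ℂ) ≠ (τ : ℂ))
    (ρ : D.nontrivialZeros) : (ρ : ℂ) ≠ 2 * ((τ / 2 : ℝ) : ℂ) - ((0 : ℝ) : ℂ) := by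
  have h2 : (2 : ℂ) * ((τ / 2 : ℝ) : ℂ) - ((0 : ℝ) : ℂ) = (τ : ℂ) := by push_cast; ring
  rw [h2]
  exact hτZ ρ

/-! ### Theorem 3.3 — the τ-Li criterion for zero-free half-planes -/

/-- **Theorem 3.3, (i) ⟺ (ii)**, for every Selberg datum and every real `τ > 0` which is not a
non-trivial zero: "`ξ_F` possesses no zeros in the half-plane `Re s > τ/2`" `⟺` "`λ_F(n,τ) ≥ 0` for all
`n ≥ 1`" (real parts).  PROVED: Sekatskii's generalized Bombieri–Lagarias theorem
(`sekatskii2014_thm2_of_lt`, `a = 0`, `σ = τ/2`) for the multiset of non-trivial zeros with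
multiplicities, whose weight is summable by `liZeroSumSummable_holds`.
[cite: BucurEtAl2016, Thm 3.3 (i)⟺(ii) (p. 264)] -/
theorem forall_re_le_iff_liTauRe_nonneg {τ : ℝ} (hτ : 0 < τ)
    (hτZ : ∀ ρ : D.nontrivialZeros, (ρ : ℂ) ≠ (τ : ℂ)) :
    (∀ ρ : D.nontrivialZeros, (ρ : ℂ).re ≤ τ / 2) ↔ ∀ n : ℕ, 1 ≤ n → 0 ≤ D.liTauRe τ n := by
  have h := sekatskii2014_thm2_of_lt (fun ρ : D.nontrivialZeros ↦ (ρ : ℂ)) (fun ρ ↦ D.zeroMult ρ)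
    (a := 0) (σ := τ / 2) (by linarith) (fun ρ ↦ zeroMult_pos ρ.2)
    (coe_ne_two_mul_half_sub_zero hτZ) (summable_sekatskiiWeight_at D.liZeroSumSummable_holds 0 (τ / 2))
  simp only [liTauRe_eq_sekatskiiSum]
  exact h

/-- **Bucur–Ernvall-Hytönen–Odžak–Smajlović 2016, Theorem 3.3, (i) ⟺ (ii)** as printed (`τ ≥ 1`;
"Let `F ∈ 𝒮_ℝ^♯` and let `τ ∈ [1, ∞)` be such that `0, τ ∉ Z(F)`.  Then the following statements
are equivalent. (i) `ξ_F` possesses no zeros in the half-plane `Re(s) > τ/2`. (ii) `λ_F(n,τ) ≥ 0` for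
all `n ≥ 1`."), typed for `F ∈ 𝒮` with real parts (TYPING NOTE in the module docstring; `0, τ ∉ Z(F)`
is automatic).  RH-FREE equivalence; neither side is asserted for `τ < 2`.
[cite: BucurEtAl2016, Thm 3.3 (i)⟺(ii) (p. 264)] -/
theorem bucurEtAl2016_thm_3_3 {τ : ℝ} (hτ : 1 ≤ τ) :
    (∀ ρ : D.nontrivialZeros, (ρ : ℂ).re ≤ τ / 2) ↔ ∀ n : ℕ, 1 ≤ n → 0 ≤ D.liTauRe τ n :=
  forall_re_le_iff_liTauRe_nonneg (by linarith) (coe_ne_of_one_le hτ)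

/-- **Theorem 3.3, (iii) ⟹ (i)**: a sub-exponential lower bound "for every `δ > 0` there is `c(δ)` with
`λ_F(n,τ) ≥ −c(δ)e^{δn}`" already forces the zero-free half-plane `Re s > τ/2`.  PROVED from the
discharged `Sekatskii2014_thm2c_holds` (Bombieri–Lagarias' condition (3), transported).
[cite: BucurEtAl2016, Thm 3.3 (iii)⟹(i) (pp. 264–266)] -/
theorem forall_re_le_of_liTauRe_subexp {τ : ℝ} (hτ : 0 < τ)
    (hτZ : ∀ ρ : D.nontrivialZeros, (ρ : ℂ) ≠ (τ : ℂ))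
    (hc : ∀ δ : ℝ, 0 < δ → ∃ c : ℝ, 0 < c ∧ ∀ n : ℕ, 1 ≤ n →
      -c * Real.exp (δ * n) ≤ D.liTauRe τ n) :
    ∀ ρ : D.nontrivialZeros, (ρ : ℂ).re ≤ τ / 2 := by
  have hc' : ∀ δ : ℝ, 0 < δ → ∃ c : ℝ, 0 < c ∧ ∀ n : ℕ, 1 ≤ n →
      -c * Real.exp (δ * n) ≤ ∑' ρ : D.nontrivialZeros, (D.zeroMult ρ : ℝ) *
        (1 - (((ρ : ℂ) - ((0 : ℝ) : ℂ)) / ((ρ : ℂ) + ((0 : ℝ) : ℂ) - 2 * ((τ / 2 : ℝ) : ℂ))) ^ n).re := by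
    simpa only [liTauRe_eq_sekatskiiSum] using hc
  exact (Sekatskii2014_thm2c_holds (fun ρ : D.nontrivialZeros ↦ (ρ : ℂ)) (fun ρ ↦ D.zeroMult ρ)
    0 (τ / 2) (by linarith) (fun ρ ↦ zeroMult_pos ρ.2) (coe_ne_two_mul_half_sub_zero hτZ)
    (summable_sekatskiiWeight_at D.liZeroSumSummable_holds 0 (τ / 2)) hc').1 (by linarith)

/-- **Theorem 3.3, (i) ⟺ (iii)** as printed (`τ ≥ 1`): "(i) `ξ_F` possesses no zeros in the half-plane
`Re(s) > τ/2`" `⟺` "(iii) for every fixed `δ > 0`, there exists a constant `c(δ)` such that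
`λ_F(n,τ) ≥ −c(δ) exp(δn)`" (typed with `c(δ) > 0`, which is no restriction).  RH-FREE equivalence.
[cite: BucurEtAl2016, Thm 3.3 (i)⟺(iii) (p. 264)] -/
theorem bucurEtAl2016_thm_3_3_iii {τ : ℝ} (hτ : 1 ≤ τ) :
    (∀ ρ : D.nontrivialZeros, (ρ : ℂ).re ≤ τ / 2) ↔
      ∀ δ : ℝ, 0 < δ → ∃ c : ℝ, 0 < c ∧ ∀ n : ℕ, 1 ≤ n →
        -c * Real.exp (δ * n) ≤ D.liTauRe τ n := by
  constructor
  · intro h δ _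
    refine ⟨1, one_pos, fun n hn ↦ ?_⟩
    have h0 := (bucurEtAl2016_thm_3_3 hτ).1 h n hn
    have : 0 < Real.exp (δ * n) := Real.exp_pos _
    linarith
  · exact forall_re_le_of_liTauRe_subexp (by linarith) (coe_ne_of_one_le hτ)

/-- The constant-bound special case of (iii): a lower bound `−K` for the τ-Li coefficients, uniform in
`n ≥ 1`, forces the zero-free half-plane (`sekatskii2014_thm2_of_bddBelow_lt`).
[cite: BucurEtAl2016, Thm 3.3 (iii)⟹(i) (special case of a constant bound)] -/
theorem forall_re_le_of_liTauRe_bddBelow {τ : ℝ} (hτ : 0 < τ)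
    (hτZ : ∀ ρ : D.nontrivialZeros, (ρ : ℂ) ≠ (τ : ℂ)) {K : ℝ}
    (hK : ∀ n : ℕ, 1 ≤ n → -K ≤ D.liTauRe τ n) :
    ∀ ρ : D.nontrivialZeros, (ρ : ℂ).re ≤ τ / 2 := by
  have hK' : ∀ n : ℕ, 1 ≤ n → -K ≤ ∑' ρ : D.nontrivialZeros, (D.zeroMult ρ : ℝ) *
      (1 - (((ρ : ℂ) - ((0 : ℝ) : ℂ)) / ((ρ : ℂ) + ((0 : ℝ) : ℂ) - 2 * ((τ / 2 : ℝ) : ℂ))) ^ n).re := by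
    simpa only [liTauRe_eq_sekatskiiSum] using hK
  exact sekatskii2014_thm2_of_bddBelow_lt (fun ρ : D.nontrivialZeros ↦ (ρ : ℂ)) (fun ρ ↦ D.zeroMult ρ)
    (a := 0) (σ := τ / 2) (by linarith) (fun ρ ↦ zeroMult_pos ρ.2)
    (coe_ne_two_mul_half_sub_zero hτZ) (summable_sekatskiiWeight_at D.liZeroSumSummable_holds 0 (τ / 2))
    hK'

/-! ### Corollary 3.4 — the strip form -/

/-- **Corollary 3.4, (i) ⟺ (ii)** (p. 266: "(i) All the non-trivial zeros of the function `F` lie in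
the strip `1 − τ/2 ≤ Re(s) ≤ τ/2`. (ii) The τ-Li coefficients `λ_F(n,τ) ≥ 0` for all `n ≥ 1`."),
`τ ≥ 1`, typed for `F ∈ 𝒮` with real parts — from Theorem 3.3 and the symmetry `ρ ↦ 1 − ρ̄` of the
zeros (functional equation, `one_sub_conj_mem_nontrivialZeros`).  RH-FREE equivalence.
[cite: BucurEtAl2016, Cor 3.4 (i)⟺(ii) (p. 266)] -/
theorem bucurEtAl2016_cor_3_4 {τ : ℝ} (hτ : 1 ≤ τ) :
    (∀ ρ : D.nontrivialZeros, 1 - τ / 2 ≤ (ρ : ℂ).re ∧ (ρ : ℂ).re ≤ τ / 2) ↔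
      ∀ n : ℕ, 1 ≤ n → 0 ≤ D.liTauRe τ n := by
  rw [← bucurEtAl2016_thm_3_3 hτ]
  constructor
  · exact fun h ρ ↦ (h ρ).2
  · intro h ρ
    refine ⟨?_, h ρ⟩
    have := h ⟨1 - conj (ρ : ℂ), one_sub_conj_mem_nontrivialZeros ρ.2⟩
    simp only [sub_re, one_re, conj_re] at this
    linarith

/-- **Corollary 3.4, (i) ⟺ (iii)** (`τ ≥ 1`): the strip statement `⟺` sub-exponential lower bounds for
the τ-Li coefficients. [cite: BucurEtAl2016, Cor 3.4 (i)⟺(iii) (p. 266)] -/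
theorem bucurEtAl2016_cor_3_4_iii {τ : ℝ} (hτ : 1 ≤ τ) :
    (∀ ρ : D.nontrivialZeros, 1 - τ / 2 ≤ (ρ : ℂ).re ∧ (ρ : ℂ).re ≤ τ / 2) ↔
      ∀ δ : ℝ, 0 < δ → ∃ c : ℝ, 0 < c ∧ ∀ n : ℕ, 1 ≤ n →
        -c * Real.exp (δ * n) ≤ D.liTauRe τ n := by
  rw [bucurEtAl2016_cor_3_4 hτ, ← bucurEtAl2016_thm_3_3 hτ, bucurEtAl2016_thm_3_3_iii hτ]

/-! ### Consequences: unconditional positivity for `τ ≥ 2`, and `τ = 1` -/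

/-- **RH-FREE positivity of the τ-Li coefficients for `τ ≥ 2`**: every non-trivial zero of `F ∈ 𝒮` has
`Re ρ < 1 ≤ τ/2`, so (i) of Theorem 3.3 holds and `Re λ_F(n,τ) ≥ 0` for all `n ≥ 1` — the
Selberg-class analogue of Freitas' unconditional half-plane positivity for `ζ` (tree:
`liSekatskiiDeriv_nonneg_of_lt_one'`).  PROVED; asserts nothing about `τ < 2`.
[cite: BucurEtAl2016, Thm 3.3 (i)⟹(ii) (p. 264)] -/
theorem liTauRe_nonneg_of_two_le {τ : ℝ} (hτ : 2 ≤ τ) {n : ℕ} (hn : 1 ≤ n) : 0 ≤ D.liTauRe τ n :=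
  (bucurEtAl2016_thm_3_3 (by linarith)).1 (fun ρ ↦ by have := ρ.2.2.2; linarith) n hn

/-- **`τ = 1`: the Li criterion for `F ∈ 𝒮` in τ-Li form** — RH for `F` (all non-trivial zeros on
`Re s = ½`) `⟺` `Re λ_F(n,1) ≥ 0` for all `n ≥ 1` (Theorem 3.3 at `τ = 1` with
`riemannHypothesis_iff_forall_re_le_half`; cf. the sibling `riemannHypothesis_iff_liCoeffRe_nonneg'`).
RH_F-EQUIVALENT as printed; neither side is asserted. [cite: BucurEtAl2016, Thm 3.3 (case τ = 1) (p. 264)] -/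
theorem riemannHypothesis_iff_liTauRe_one_nonneg :
    D.RiemannHypothesis ↔ ∀ n : ℕ, 1 ≤ n → 0 ≤ D.liTauRe 1 n := by
  rw [riemannHypothesis_iff_forall_re_le_half]
  exact bucurEtAl2016_thm_3_3 le_rfl

/-! ### `τ = 1` is Li's criterion: `Re λ_F(n,1) = Re λ_F(n)` -/

/-- **Multiplicities are invariant under `ρ ↦ 1 − ρ̄`**: the functional equation
`Φ_F(s) = ω conj Φ_F(1 − s̄)` on the open strip (`completed_eq`) transports the order of vanishing
(`Soundararajan2004.analyticOrderAt_conj_comp_one_sub_conj`).  PROVED.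
[cite: BucurEtAl2016, Prop 2.1 (i) (p. 261)] -/
theorem zeroMult_one_sub_conj {ρ : ℂ} (h0 : 0 < ρ.re) (h1 : ρ.re < 1) :
    D.zeroMult (1 - conj ρ) = D.zeroMult ρ := by
  have hρne : ρ ≠ 1 := by rintro rfl; simp at h1
  have h0' : 0 < (1 - conj ρ).re := by simp; linarith
  have hne' : 1 - conj ρ ≠ 1 := by
    intro h; have := congrArg Complex.re h; simp at this; linarith
  have han : AnalyticAt ℂ D.completed ρ := D.analyticOnNhd_completed ρ ⟨h0, hρne⟩
  have han' : AnalyticAt ℂ D.completed (1 - conj ρ) := D.analyticOnNhd_completed _ ⟨h0', hne'⟩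
  have hstrip : IsOpen {z : ℂ | 0 < z.re ∧ z.re < 1} :=
    (isOpen_lt continuous_const continuous_re).inter (isOpen_lt continuous_re continuous_const)
  have hFE : D.completed =ᶠ[𝓝 ρ] fun z ↦ conj (D.completed (1 - conj z)) * D.rootNumber := by
    filter_upwards [hstrip.mem_nhds ⟨h0, h1⟩] with z hz
    rw [D.completed_eq z hz.1 hz.2, mul_comm]
  have hord : analyticOrderAt D.completed ρ = analyticOrderAt D.completed (1 - conj ρ) := by
    rw [Soundararajan2004.analyticOrderAt_eq_of_eventuallyEq_mul
      (Soundararajan2004.analyticAt_conj_comp_one_sub_conj han') analyticAt_const D.rootNumber_ne_zero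
      hFE]
    exact Soundararajan2004.analyticOrderAt_conj_comp_one_sub_conj han'
  unfold zeroMult
  rw [han.meromorphicOrderAt_eq, han'.meromorphicOrderAt_eq, hord]

/-- The reflected term: `1 − 1/(1 − ρ̄) = conj(ρ/(ρ − 1))`, so
`Re[1 − (1 − 1/(1−ρ̄))ⁿ] = Re[1 − (ρ/(ρ−1))ⁿ]` (`Re ρ < 1`). [folklore] -/
private theorem re_term_one_sub_conj {ρ : ℂ} (h1 : ρ.re < 1) (n : ℕ) :
    (1 - (1 - 1 / (1 - conj ρ)) ^ n).re = (1 - (ρ / (ρ - 1)) ^ n).re := by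
  have hc1 : (1 : ℂ) - conj ρ ≠ 0 := by
    intro h
    have := congrArg Complex.re h
    simp at this
    linarith
  have hc2 : conj ρ - 1 ≠ 0 := fun h ↦ hc1 (by rw [← neg_sub, h, neg_zero])
  have key : (1 : ℂ) - 1 / (1 - conj ρ) = conj (ρ / (ρ - 1)) := by
    rw [map_div₀, map_sub, map_one]
    field_simp
    ring
  rw [key, ← map_pow, show (1 : ℂ) - conj ((ρ / (ρ - 1)) ^ n) = conj (1 - (ρ / (ρ - 1)) ^ n) by
    rw [map_sub, map_one], Complex.conj_re]

/-- **`Re λ_F(n,1) = Re λ_F(n)`**: at `τ = 1` the τ-Li coefficients ARE the Li coefficients of the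
sibling file (`liCoeffRe`, `λ_F(n) = Σ_ρ [1 − (1 − 1/ρ)ⁿ]`): re-index the absolutely convergent sum by
the involution `ρ ↦ 1 − ρ̄` of the non-trivial zeros (`one_sub_conj_mem_nontrivialZeros`), which
preserves multiplicities (`zeroMult_one_sub_conj`) and maps `1 − 1/ρ` to `conj(ρ/(ρ−1))` ("`λ_F(−n) =
conj λ_F(n)`", [BucurEtAl2016, §1]; for `ζ`: `k_{n,0} = k_{n,1} = λ_n`, tree `liSekatskiiSum_zero`).
PROVED; so `riemannHypothesis_iff_liTauRe_one_nonneg` is literally the sibling's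
`riemannHypothesis_iff_liCoeffRe_nonneg'`. [cite: BucurEtAl2016, eq. (1.2) and §1 (p. 260)] -/
theorem liTauRe_one_eq_liCoeffRe (n : ℕ) : D.liTauRe 1 n = D.liCoeffRe n := by
  set f : D.nontrivialZeros → D.nontrivialZeros :=
    fun ρ ↦ ⟨1 - conj (ρ : ℂ), one_sub_conj_mem_nontrivialZeros ρ.2⟩ with hf
  have hinv : Function.Involutive f := fun ρ ↦ Subtype.ext (by simp [hf])
  set e : Equiv.Perm D.nontrivialZeros := hinv.toPerm f with he
  set G : D.nontrivialZeros → ℝ := fun ρ ↦ (D.zeroMult ρ : ℝ) * (1 - (1 - 1 / (ρ : ℂ)) ^ n).re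
    with hG
  have key : ∀ ρ : D.nontrivialZeros,
      G (e ρ) = (D.zeroMult ρ : ℝ) * (1 - ((ρ : ℂ) / ((ρ : ℂ) - ((1 : ℝ) : ℂ))) ^ n).re := by
    intro ρ
    obtain ⟨-, h0, h1⟩ := ρ.2
    have heρ : ((e ρ : D.nontrivialZeros) : ℂ) = 1 - conj (ρ : ℂ) := rfl
    rw [hG]
    simp only
    rw [heρ, zeroMult_one_sub_conj h0 h1, re_term_one_sub_conj h1, Complex.ofReal_one]
  calc D.liTauRe 1 n = ∑' ρ : D.nontrivialZeros, G (e ρ) := by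
        unfold liTauRe; exact tsum_congr fun ρ ↦ (key ρ).symm
    _ = ∑' ρ : D.nontrivialZeros, G ρ := e.tsum_eq G
    _ = D.liCoeffRe n := rfl

/-- Hence also `Re λ_F(n,0) = Re λ_F(n)` for the Li–Sekatskii sum at base point `a = 0` (the
Selberg-class form of `k_{n,0} = λ_n`). [cite: BucurEtAl2016, eq. (1.2) (p. 260)] -/
theorem liSekatskiiRe_zero_eq_liCoeffRe (n : ℕ) : D.liSekatskiiRe 0 n = D.liCoeffRe n := by
  rw [← liTauRe_one_eq_liSekatskiiRe_zero, liTauRe_one_eq_liCoeffRe]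

end SelbergDatum

end Literature.NumberTheory.LFunctions

end
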